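import Literature.MathematicalPhysics.QuantumFieldTheory.Balaban1983to89.B6CoverNested

/-!
# `Balaban1983to89.B6CoverNestedPart2` — T. Bałaban, *Propagators and renormalization transformations for lattice gauge
theories. II*, Commun. Math. Phys. **96** (1984) 223–250 [Balaban1984PropagatorsII], p. 229 and (2.36): Part 2 of
`…B6CoverNested` (the cover 𝒟 = ⋃_j 𝒟_j and its partition of unity on the nested cube-union geometry of `…B6BoxChartsNested`;
split for the 400-line cap, LEAN-PLAN §4.1) — finite overlap, the bulk, the three felt levels under the separation clause of
(2.2), and the big-block structure of B^j(Λ_j) and of the centres of 𝒟_j under (2.1)–(2.2)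

statement-level skeleton of published theorems with citation tags; proofs where landed; nothing here is a claim about the Yang–Mills mass gap

PDF held: `paper:balaban1984-cmp96-propagators-rt-ii` (journal page = PDF page + 222); renders of pp. 224, 229 re-read AS IMAGES
this session (quotations in the header of `…B6CoverNested`).

WHAT IS REPRODUCED.  SKELETON row **B6.Eq2.36**, continued (cell `lit-balaban`, HOME `run/shared/lean/pub/lit-balaban/`,
Phase-2 seat p02 = unit `lit-balaban-p02`).  p. 229: *"Each set Λ_j is a sum of big blocks of the size ML^jη … We cover
B^j(Λ_j) by a sum of cubes □ of the size 2ML^jη, each cube being a sum of 2^d big blocks with a center y ∈ Λ_j (more exactly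
it belongs to the boundary of this set also)."*; p. 224 (2.2): *"Ω_j = B^j(Ω_j^{(j)}) … and it is a sum of big blocks,
(L^jη)^{−1} dist(Ω_j^c, Ω_{j+1}) > RM"*.  Objects (`terr`, `IsCtr`, `cover`, `htl`, `sqS`, `hfun`, `near`, `side`, `winZ`,
`bumpZ`) and (2.36) itself (`sum_h_sq_eq_one`) are those of Part 1.

PROVED (no `sorry`; standard axioms).  §6 FINITE OVERLAP: at most (k+1)·2^d cubes of 𝒟 are felt at a point
(`card_near_le`: 2^d per level — *"each cube being a sum of 2^d big blocks"*).  §7 THE BULK: a level j′ whose territory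
B^{j′}(Λ_{j′}) is at sup-distance ≥ 2M₀L^{j′} from x contributes nothing at x (`levelSum_eq_zero_of_far`: a felt cube is
centred within ⅔M₀L^{j′} of x and within M₀L^{j′} of its territory), so at a point of B^j(Λ_j) that far from every other
territory S = 1 and h_□ = h̃_□ — the matching normalisation of Part 1 acts only along the interfaces (`sqS_eq_one_of_far`).
§8 UNDER THE SEPARATION CLAUSE of (2.2) (`…B6BoxChartsNested.L1Sep` with R ≥ 2dL, nesting (2.1)): a point of B^j(Λ_j) is
at sup-distance > 2M₀L^{j′} from every territory with |j′ − j| ≥ 2 (`far_of_l1Sep`), hence only the levels j − 1, j, j + 1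
are felt and 1 ≤ S ≤ 3 uniformly in k (`levelSum_eq_zero_of_l1Sep`, `sqS_le_three_of_l1Sep`; cf. n₀ = 3·2^d of the box
tower `…B6TowerCover`).  §9 UNDER (2.1)–(2.2) (`Nested`, `CubeUnions`): big blocks nest (`isCubeUnion_of_mul`), B^j(Λ_j) is
a union of big blocks of side M₀L^j (`isCubeUnion_terr`), every centre of 𝒟_j is a vertex of a big block of B^j(Λ_j)
(`exists_block_of_isCtr`) and conversely every such vertex is a centre when M₀L^j ≥ 2 (`isCtr_of_block`) — the printed
*"center y ∈ Λ_j (more exactly it belongs to the boundary of this set also)"* made exact in the model.  §10 NON-VACUITY: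
on the half-line geometry Ω₁ = {0 ≤ x₀} (d = 1, k = 1, L = M₀ = 2) all of (2.1), (2.2) (any R) hold, (2.36) holds, and
S(−1) = 2 next to ∂Ω₁ (`hsTower_interface_witness`) — both adjacent families are complete there, so the matching
convention h = h̃·S^{−1∕2} is genuinely at work (the obstruction `…B6CoverTwoLevel.sqS_corner_eq_two` in this model).

HONEST SCOPE.  As Part 1: a modelling leaf on ℤ^d; the threshold R ≥ 2dL of §8 is what sup-norm supports and the ℓ¹
clause give (two passages ℓ¹ ↔ ℓ^∞), not Bałaban's R; nothing on G′, R of (2.37)–(2.38), on d = 4 or the continuum; NOT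
summit progress.
-/

namespace Literature.MathematicalPhysics.QuantumFieldTheory.Balaban1983to89.B6CoverNestedPart2

open Finset
open Literature.Probability.LatticeModels
open B6BoxCharts (blockAtlas mem_blockBox_iff blockIdx blockIdx_apply mem_blockBox_blockIdx latL1Dist_le_mul_supDist)
open B6BoxChartsCubeUnions (IsCubeUnion isCubeUnion_univ isCubeUnion_empty)
open B6BoxChartsNested (pzLevel pzLevel_le le_pzLevel not_mem_of_pzLevel_lt mem_of_le_pzLevel Nested CubeUnions L1Sep
  hsTower hsTower_nested hsTower_cubeUnions)
open B6CoverBox (prof_of_abs_le)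
open B6CoverNested

variable {d : ℕ} {k L M₀ : ℕ} {Ω : ℕ → Set (Site d)}

/-! ## §6  Finite overlap -/

/-- No territory beyond level k. [cite: Balaban1984PropagatorsII, (2.4) p.224] -/
theorem terr_of_lt {j : ℕ} (hj : k < j) : terr k Ω j = ∅ :=
  Set.eq_empty_iff_forall_notMem.2 fun _ h => absurd (le_of_mem_terr h) (not_le.2 hj)

/-- At most 2^d centres of ONE level are felt at a point (in each coordinate the two admissible centres are consecutive
lattice points) — *"each cube being a sum of 2^d big blocks"*. [cite: Balaban1984PropagatorsII, p.229 before (2.36)] -/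
theorem card_winZ_le (s : ℕ) (x : Site d) : (winZ s x).card ≤ 2 ^ d := by
  rw [winZ, Fintype.card_piFinset]
  exact (Finset.prod_le_pow_card _ _ _ fun μ _ => Finset.card_le_two).trans (by rw [Finset.card_univ, Fintype.card_fin])

/-- **Finite overlap**: at most (k+1)·2^d cubes of 𝒟 are felt at any point (h̃_□(x) = 0 outside `near`, Part 1).
[cite: Balaban1984PropagatorsII, p.229 before (2.36)] -/
theorem card_near_le (x : Site d) : (near k L M₀ x).card ≤ (k + 1) * 2 ^ d :=
  calc (near k L M₀ x).card
      ≤ ∑ j ∈ Finset.range (k + 1), ((winZ (side L M₀ j) x).image fun n => (j, n)).card := Finset.card_biUnion_le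
    _ ≤ ∑ j ∈ Finset.range (k + 1), 2 ^ d := Finset.sum_le_sum fun j _ => Finset.card_image_le.trans (card_winZ_le _ x)
    _ = (k + 1) * 2 ^ d := by rw [Finset.sum_const, Finset.card_range, smul_eq_mul]

/-! ## §7  The bulk: far territories are not felt; there S = 1 and h_□ = h̃_□ -/

/-- A cube of 𝒟_{j′} felt at x has its centre within ⅔M₀L^{j′} of x and within M₀L^{j′} of B^{j′}(Λ_{j′}): a point at
sup-distance ≥ 2M₀L^{j′} from B^{j′}(Λ_{j′}) feels no cube of 𝒟_{j′}. [cite: Balaban1984PropagatorsII, p.229 before (2.36)] -/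
theorem bumpZ_eq_zero_of_far (hL : 1 ≤ L) (hM₀ : 1 ≤ M₀) {j' : ℕ} {x : Site d}
    (hfar : ∀ y ∈ terr k Ω j', 2 * side L M₀ j' ≤ supDist x y) {n : Site d} (hn : IsCtr k L M₀ Ω j' n) :
    bumpZ (side L M₀ j') n x = 0 := by
  obtain ⟨y, hy, hyn⟩ := hn
  by_contra hb
  have hle : supDist x y ≤ 2 * side L M₀ j' - 1 := by
    refine supDist_le_iff.2 fun μ => ?_
    have a1 := abs_lt_of_bumpZ_ne_zero (side_pos hL hM₀ j') hb μ
    have a2 := hyn μ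
    have a3 := abs_sub_le (x μ) ((side L M₀ j' : ℤ) * n μ) (y μ)
    rw [abs_sub_comm ((side L M₀ j' : ℤ) * n μ) (y μ)] at a3
    have a0 := abs_nonneg (x μ - (side L M₀ j' : ℤ) * n μ)
    have hz : ((x μ - y μ).natAbs : ℤ) < 2 * (side L M₀ j' : ℤ) := by
      rw [Int.natCast_natAbs]
      linarith
    omega
  have := hfar y hy
  have hs := side_pos hL hM₀ j'
  omega

/-- … so the level j′ contributes nothing to S at such a point. [cite: Balaban1984PropagatorsII, (2.36) p.229] -/
theorem levelSum_eq_zero_of_far (hL : 1 ≤ L) (hM₀ : 1 ≤ M₀) {j' : ℕ} {x : Site d}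
    (hfar : ∀ y ∈ terr k Ω j', 2 * side L M₀ j' ≤ supDist x y) :
    ∑ n ∈ winZ (side L M₀ j') x, htl k L M₀ Ω (j', n) x ^ 2 = 0 := by
  refine Finset.sum_eq_zero fun n _ => ?_
  rw [htl_mk]
  split_ifs with hc
  · rw [bumpZ_eq_zero_of_far hL hM₀ hfar hc, zero_pow two_ne_zero]
  · exact zero_pow two_ne_zero

/-- **S = 1 and h_□ = h̃_□ in the bulk**: at a point of B^j(Λ_j) at sup-distance ≥ 2M₀L^{j′} from every other territory
B^{j′}(Λ_{j′}) the square sum S is the level-j sum alone, = 1 (Part 1 `levelSum_eq_one`) — the matching normalisation acts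
only along the interfaces ∂Λ_{j+1}. [cite: Balaban1984PropagatorsII, (2.36) p.229] -/
theorem sqS_eq_one_of_far (hL : 1 ≤ L) (hM₀ : 1 ≤ M₀) {j : ℕ} {x : Site d} (hx : x ∈ terr k Ω j)
    (hfar : ∀ j', j' ≤ k → j' ≠ j → ∀ y ∈ terr k Ω j', 2 * side L M₀ j' ≤ supDist x y) :
    sqS k L M₀ Ω x = 1 ∧ ∀ q, hfun k L M₀ Ω q x = htl k L M₀ Ω q x := by
  have hS : sqS k L M₀ Ω x = 1 := by
    unfold sqS
    rw [Finset.sum_eq_single_of_mem j (Finset.mem_range.2 (Nat.lt_succ_of_le (le_of_mem_terr hx)))]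
    · exact levelSum_eq_one hL hM₀ hx
    · exact fun j' hj' hne => levelSum_eq_zero_of_far hL hM₀ (hfar j' (Nat.lt_succ_iff.1 (Finset.mem_range.1 hj')) hne)
  exact ⟨hS, fun q => by rw [hfun, hS, Real.sqrt_one, div_one]⟩

/-! ## §8  Under the separation clause of (2.2): only the levels j − 1, j, j + 1 are felt; S ≤ 3 -/

/-- **Far territories under the separation clause** (nesting (2.1), `L1Sep` with R ≥ 2dL): a point of B^j(Λ_j) is at
sup-distance ≥ 2M₀L^{j′} from B^{j′}(Λ_{j′}) whenever |j′ − j| ≥ 2 — for j′ ≥ j + 2 the point lies outside Ω_{j′−1} and the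
territory inside Ω_{j′} (ℓ¹-gap > R·M₀L^{j′−1} ≥ 2d·M₀L^{j′}); for j′ ≤ j − 2 the territory lies outside Ω_{j′+1} and the
point inside Ω_{j′+2} (gap > R·M₀L^{j′+1} ≥ 2d·M₀L^{j′}); and ‖·‖₁ ≤ d‖·‖_∞. [cite: Balaban1984PropagatorsII, (2.2) p.224] -/
theorem far_of_l1Sep (hL : 1 ≤ L) (hnest : Nested k Ω) {R : ℕ} (hsep : L1Sep k L M₀ R Ω) (hR : 2 * d * L ≤ R)
    {j : ℕ} {x : Site d} (hx : x ∈ terr k Ω j) {j' : ℕ} (hj' : j' ≤ k) (hjj' : j' + 2 ≤ j ∨ j + 2 ≤ j')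
    {y : Site d} (hy : y ∈ terr k Ω j') : 2 * side L M₀ j' ≤ supDist x y := by
  have hj : j ≤ k := le_of_mem_terr hx
  have hxj : pzLevel k Ω x = j := hx
  have hyj : pzLevel k Ω y = j' := hy
  rcases Nat.eq_zero_or_pos d with hd | hd
  · subst hd
    rw [Subsingleton.elim x y, hyj] at hxj
    omega
  rcases hjj' with h | h
  · have hy1 : y ∉ Ω (j' + 1) := not_mem_of_pzLevel_lt (by rw [hyj]; exact Nat.lt_succ_self _) (by omega)
    have hx2 : x ∈ Ω (j' + 1 + 1) := mem_of_le_pzLevel hnest (by omega) (by rw [hxj]; omega)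
    have h1 := hsep (j' + 1) (by omega) (by omega) hy1 hx2
    have h2 := latL1Dist_le_mul_supDist y x
    rw [supDist_comm] at h2
    have h3 : d * (2 * side L M₀ j') ≤ R * (M₀ * L ^ (j' + 1)) :=
      calc d * (2 * side L M₀ j') = 2 * d * 1 * (M₀ * L ^ j') := by unfold side; ring
        _ ≤ 2 * d * L * (M₀ * L ^ j') := Nat.mul_le_mul_right _ (Nat.mul_le_mul_left _ hL)
        _ ≤ R * (M₀ * L ^ j') := Nat.mul_le_mul_right _ hR
        _ ≤ R * (M₀ * L ^ (j' + 1)) :=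
          Nat.mul_le_mul_left _ (Nat.mul_le_mul_left _ (Nat.pow_le_pow_right hL (Nat.le_succ _)))
    exact (Nat.lt_of_mul_lt_mul_left (lt_of_le_of_lt h3 (lt_of_lt_of_le h1 h2))).le
  · obtain ⟨m, rfl⟩ : ∃ m, j' = m + 1 := ⟨j' - 1, by omega⟩
    have hx1 : x ∉ Ω m := not_mem_of_pzLevel_lt (by rw [hxj]; omega) (by omega)
    have hy2 : y ∈ Ω (m + 1) := mem_of_le_pzLevel hnest (by omega) (by rw [hyj])
    have h1 := hsep m (by omega) (by omega) hx1 hy2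
    have h2 := latL1Dist_le_mul_supDist x y
    have h3 : d * (2 * side L M₀ (m + 1)) ≤ R * (M₀ * L ^ m) :=
      calc d * (2 * side L M₀ (m + 1)) = 2 * d * L * (M₀ * L ^ m) := by unfold side; ring
        _ ≤ R * (M₀ * L ^ m) := Nat.mul_le_mul_right _ hR
    exact (Nat.lt_of_mul_lt_mul_left (lt_of_le_of_lt h3 (lt_of_lt_of_le h1 h2))).le

/-- Hence under the separation clause a cube of 𝒟_{j′} with |j′ − j| ≥ 2 is not felt on B^j(Λ_j): its level contributes
nothing to S there. [cite: Balaban1984PropagatorsII, (2.36) p.229] -/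
theorem levelSum_eq_zero_of_l1Sep (hL : 1 ≤ L) (hM₀ : 1 ≤ M₀) (hnest : Nested k Ω) {R : ℕ} (hsep : L1Sep k L M₀ R Ω)
    (hR : 2 * d * L ≤ R) {j : ℕ} {x : Site d} (hx : x ∈ terr k Ω j) {j' : ℕ} (hjj' : j' + 2 ≤ j ∨ j + 2 ≤ j') :
    ∑ n ∈ winZ (side L M₀ j') x, htl k L M₀ Ω (j', n) x ^ 2 = 0 := by
  by_cases hj' : j' ≤ k
  · exact levelSum_eq_zero_of_far hL hM₀ fun y hy => far_of_l1Sep hL hnest hsep hR hx hj' hjj' hy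
  · refine levelSum_eq_zero_of_far hL hM₀ fun y hy => ?_
    rw [terr_of_lt (not_le.1 hj')] at hy
    exact absurd hy (Set.notMem_empty y)

/-- **Only three levels are felt: 1 ≤ S ≤ 3 under the separation clause**, uniformly in the number of levels k (the
levels j − 1, j, j + 1 contribute ≤ 1 each, all others 0; cf. the overlap 3·2^d of the box tower `…B6TowerCover`).
[cite: Balaban1984PropagatorsII, (2.36) p.229] -/
theorem sqS_le_three_of_l1Sep (hL : 1 ≤ L) (hM₀ : 1 ≤ M₀) (hnest : Nested k Ω) {R : ℕ} (hsep : L1Sep k L M₀ R Ω)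
    (hR : 2 * d * L ≤ R) (x : Site d) : sqS k L M₀ Ω x ≤ 3 := by
  set j := pzLevel k Ω x with hj
  have hx : x ∈ terr k Ω j := mem_terr_pzLevel x
  set T : Finset ℕ := {j - 1, j, j + 1} with hT
  unfold sqS
  rw [← Finset.sum_filter_of_ne (p := fun j' => j' ∈ T) (fun j' _ hne => by
    by_contra hj'T
    refine hne (levelSum_eq_zero_of_l1Sep hL hM₀ hnest hsep hR hx ?_)
    simp only [hT, Finset.mem_insert, Finset.mem_singleton] at hj'T
    omega)]
  calc ∑ j' ∈ (Finset.range (k + 1)).filter (fun j' => j' ∈ T), ∑ n ∈ winZ (side L M₀ j') x, htl k L M₀ Ω (j', n) x ^ 2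
      ≤ ∑ j' ∈ (Finset.range (k + 1)).filter (fun j' => j' ∈ T), (1 : ℝ) :=
        Finset.sum_le_sum fun j' _ => levelSum_le_one hL hM₀ j' x
    _ = (((Finset.range (k + 1)).filter (fun j' => j' ∈ T)).card : ℝ) := by simp
    _ ≤ (T.card : ℝ) := by exact_mod_cast Finset.card_le_card fun j' hj' => (Finset.mem_filter.1 hj').2
    _ ≤ 3 := by exact_mod_cast Finset.card_le_three

/-! ## §9  Under (2.1)–(2.2): B^j(Λ_j) is a union of big blocks; the centres of 𝒟_j are the big-block vertices of B^j(Λ_j) -/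

/-- Blocks of side M nest in blocks of side M·c (c ≥ 1): a union of big blocks of the next level is a union of big blocks of
this level (*"it is a sum of big blocks"*). [cite: Balaban1984PropagatorsII, (2.2) p.224] -/
theorem isCubeUnion_of_mul {M c : ℕ} (hc : 0 < c) {Λ : Set (Site d)} (h : IsCubeUnion (M * c) Λ) : IsCubeUnion M Λ := by
  have key : ∀ (a y : Site d), y ∈ (blockAtlas d M).box a → y ∈ (blockAtlas d (M * c)).box (fun i => a i / (c : ℤ)) := by
    intro a y hy
    rw [mem_blockBox_iff] at hy ⊢
    intro i
    obtain ⟨h1, h2⟩ := hy i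
    have hc' : (0 : ℤ) < c := by exact_mod_cast hc
    have hM : (0 : ℤ) ≤ M := Int.natCast_nonneg M
    have p1 : (M : ℤ) * (a i / (c : ℤ) * (c : ℤ)) ≤ (M : ℤ) * a i :=
      mul_le_mul_of_nonneg_left (Int.ediv_mul_le _ hc'.ne') hM
    have p2 : (M : ℤ) * (a i + 1) ≤ (M : ℤ) * ((a i / (c : ℤ) + 1) * (c : ℤ)) :=
      mul_le_mul_of_nonneg_left (Int.lt_ediv_add_one_mul_self (a i) hc') hM
    push_cast
    constructor <;> linarith
  intro a x hx hxΛ z hz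
  exact h (key a x hx) hxΛ (key a z hz)

/-- **B^j(Λ_j) is a union of big blocks of side M₀L^j** under (2.1)–(2.2) (*"Each set Λ_j is a sum of big blocks of the size
ML^jη"*): Ω₁ᶜ, Ω_j ∩ Ω_{j+1}ᶜ, Ω_k are, the big blocks of Ω_{j+1} being unions of those of level j.
[cite: Balaban1984PropagatorsII, p.229 before (2.36)] -/
theorem isCubeUnion_terr (hL : 1 ≤ L) (hnest : Nested k Ω) (hcube : CubeUnions k L M₀ Ω) (j : ℕ) :
    IsCubeUnion (side L M₀ j) (terr k Ω j) := by
  rcases Nat.eq_zero_or_pos k with hk | hk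
  · subst hk
    rcases Nat.eq_zero_or_pos j with hj | hj
    · subst hj
      rw [show terr 0 Ω 0 = Set.univ from Set.eq_univ_of_forall fun x => Nat.le_zero.1 (pzLevel_le x)]
      exact isCubeUnion_univ
    · rw [terr_of_lt hj]
      exact isCubeUnion_empty
  · rcases Nat.eq_zero_or_pos j with hj | hj
    · subst hj
      rw [terr_zero hnest hk]
      have h1 : IsCubeUnion (side L M₀ 0 * L) (Ω 1) := by simpa [side] using hcube 1 le_rfl hk
      exact (isCubeUnion_of_mul hL h1).compl
    · rcases lt_trichotomy j k with hjk | rfl | hjk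
      · rw [terr_mid hnest hj hjk]
        have h1 : IsCubeUnion (side L M₀ j * L) (Ω (j + 1)) := by
          simpa [side, pow_succ, mul_assoc] using hcube (j + 1) (Nat.succ_pos j) hjk
        exact (hcube j hj hjk.le).inter (isCubeUnion_of_mul hL h1).compl
      · rw [terr_top hnest hj]
        exact hcube j hj le_rfl
      · rw [terr_of_lt hjk]
        exact isCubeUnion_empty

/-- **Every centre of 𝒟_j is a vertex of a big block of B^j(Λ_j)** (*"with a center y ∈ Λ_j (more exactly it belongs to the
boundary of this set also)"*): under (2.1)–(2.2), one of the 2^d big blocks of side M₀L^j with vertex (M₀L^j)·n lies in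
B^j(Λ_j). [cite: Balaban1984PropagatorsII, p.229 before (2.36)] -/
theorem exists_block_of_isCtr (hL : 1 ≤ L) (hM₀ : 1 ≤ M₀) (hnest : Nested k Ω) (hcube : CubeUnions k L M₀ Ω)
    {j : ℕ} {n : Site d} (h : IsCtr k L M₀ Ω j n) :
    ∃ a : Site d, (∀ μ, a μ = n μ - 1 ∨ a μ = n μ) ∧ (blockAtlas d (side L M₀ j)).box a ⊆ terr k Ω j := by
  obtain ⟨x, hx, hxn⟩ := h
  have hs := side_pos hL hM₀ j
  have hs' : (0 : ℤ) < side L M₀ j := by exact_mod_cast hs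
  refine ⟨blockIdx (side L M₀ j) x, fun μ => ?_, isCubeUnion_terr hL hnest hcube j (mem_blockBox_blockIdx hs x) hx⟩
  rw [blockIdx_apply]
  obtain ⟨h1, h2⟩ := abs_lt.1 (hxn μ)
  have lo : n μ - 1 ≤ x μ / (side L M₀ j : ℤ) := by
    rw [Int.le_ediv_iff_mul_le hs']
    linarith
  have hi : x μ / (side L M₀ j : ℤ) < n μ + 1 := by
    rw [Int.ediv_lt_iff_lt_mul hs']
    linarith
  omega

/-- **… and conversely every vertex of a big block of B^j(Λ_j) is a centre of 𝒟_j** (big blocks of side M₀L^j ≥ 2; for side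
1 the lattice cannot see the closure). [cite: Balaban1984PropagatorsII, p.229 before (2.36)] -/
theorem isCtr_of_block {j : ℕ} (hs2 : 2 ≤ side L M₀ j) {n a : Site d} (ha : ∀ μ, a μ = n μ - 1 ∨ a μ = n μ)
    (hsub : (blockAtlas d (side L M₀ j)).box a ⊆ terr k Ω j) : IsCtr k L M₀ Ω j n := by
  have hs2' : (2 : ℤ) ≤ (side L M₀ j : ℤ) := by exact_mod_cast hs2
  refine ⟨fun μ => if a μ = n μ then (side L M₀ j : ℤ) * n μ else (side L M₀ j : ℤ) * n μ - 1, hsub ?_, fun μ => ?_⟩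
  · rw [mem_blockBox_iff]
    intro μ
    by_cases h : a μ = n μ
    · rw [if_pos h, h]
      constructor <;> linarith
    · rw [if_neg h, (ha μ).resolve_right h]
      constructor <;> linarith
  · dsimp only
    by_cases h : a μ = n μ
    · rw [if_pos h, sub_self, abs_zero]
      linarith
    · rw [if_neg h, sub_sub_cancel_left, abs_neg, abs_one]
      linarith

/-! ## §10  Non-vacuity and the interface obstruction in the nested model -/

/-- **All hypotheses hold together, and the matching convention is at work**: in d = 1 with one coarse level (k = 1,
L = M₀ = 2, Ω₁ = {0 ≤ x₀} = `hsTower 0`) the nesting (2.1), the big-block clause and the separation clause of (2.2) (any R)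
hold, (2.36) holds, and at the level-0 point −1 next to ∂Ω₁ BOTH families 𝒟₀, 𝒟₁ are complete: S(−1) = 2 (the interface
obstruction `…B6CoverTwoLevel.sqS_corner_eq_two` in the nested model; there h_□ = h̃_□∕√2 ≠ h̃_□).
[cite: Balaban1984PropagatorsII, (2.36) p.229] -/
theorem hsTower_interface_witness (R : ℕ) :
    Nested 1 (hsTower (0 : Fin 1)) ∧ CubeUnions 1 2 2 (hsTower (0 : Fin 1)) ∧ L1Sep 1 2 2 R (hsTower (0 : Fin 1)) ∧
      (∑ᶠ q, hfun 1 2 2 (hsTower (0 : Fin 1)) q (fun _ => -1) ^ 2 = 1) ∧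
      sqS 1 2 2 (hsTower (0 : Fin 1)) (fun _ => -1) = 2 := by
  have hnest : Nested 1 (hsTower (0 : Fin 1)) := hsTower_nested 0 1
  have hx0 : (fun _ => (-1 : ℤ)) ∈ terr 1 (hsTower (0 : Fin 1)) 0 := by
    rw [terr_zero hnest le_rfl]
    show ¬ ((0 : ℤ) ≤ -1)
    omega
  have hterr1 : terr 1 (hsTower (0 : Fin 1)) 1 = hsTower (0 : Fin 1) 1 := terr_top hnest le_rfl
  refine ⟨hnest, hsTower_cubeUnions 0 1 2 2, fun j h1 h2 => absurd h2 (by omega),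
    sum_h_sq_eq_one (by norm_num) (by norm_num) _, ?_⟩
  have hside : side 2 2 1 = 4 := by norm_num [side]
  unfold sqS
  rw [Finset.sum_range_succ, Finset.sum_range_one, levelSum_eq_one (by norm_num) (by norm_num) hx0, hside]
  have hmem : (fun _ => (0 : ℤ)) ∈ winZ 4 (fun _ : Fin 1 => (-1 : ℤ)) := by
    rw [winZ, Fintype.mem_piFinset]
    intro μ
    show (0 : ℤ) ∈ win 4 (-1)
    decide
  have hc : IsCtr 1 2 2 (hsTower (0 : Fin 1)) 1 (fun _ => (0 : ℤ)) := by
    refine ⟨fun _ => 0, ?_, fun μ => ?_⟩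
    · rw [hterr1]
      show (0 : ℤ) ≤ 0
      exact le_rfl
    · rw [hside]
      norm_num
  have hb : bumpZ 4 (fun _ => (0 : ℤ)) (fun _ : Fin 1 => (-1 : ℤ)) = 1 := by
    rw [bumpZ, Fin.prod_univ_one]
    apply prof_of_abs_le
    norm_num [abs_div]
  rw [Finset.sum_eq_single_of_mem _ hmem, htl_mk, if_pos hc, hside, hb]
  · norm_num
  · intro n hn hne
    have h0 : n 0 = -1 := by
      rw [winZ, Fintype.mem_piFinset] at hn
      have h := hn 0
      have hw : win 4 (-1) = ({-1, 0} : Finset ℤ) := by decide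
      rw [hw, Finset.mem_insert, Finset.mem_singleton] at h
      rcases h with h | h
      · exact h
      · exact absurd (funext fun μ => by rw [Fin.fin_one_eq_zero μ]; exact h) hne
    have hnot : ¬ IsCtr 1 2 2 (hsTower (0 : Fin 1)) 1 n := by
      rintro ⟨y, hy, hyn⟩
      rw [hterr1] at hy
      have hy0 : (0 : ℤ) ≤ y 0 := hy
      have h4 := hyn 0
      rw [hside, h0, abs_lt] at h4
      push_cast at h4
      omega
    rw [htl_mk, if_neg hnot, zero_pow two_ne_zero]

end Literature.MathematicalPhysics.QuantumFieldTheory.Balaban1983to89.B6CoverNestedPart2
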